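import Literature.IUT.HodgeArakelov.StableCurveAgreementOfPiCHatPackage
import Literature.IUT.HodgeArakelov.StableCurveAgreementInertiaZHat
import Literature.IUT.HodgeArakelov.LabelClassesOfCuspsRmk231Genuine
import Literature.AnabelianGeometry.EtaleTheta.SettingModelIndependence
import HarnessLib

/-!
# [IUTchII] Def 2.3 (ii) at `v ∈ 𝕍^bad` — NON-VACUITY of the cuspidal inertia families of an agreement, at every level
# of the `±`-tower, generically and at the tower of record `PlusMinusTower.ofPiCHat` (proof-only, 0 defs)

S. Mochizuki, *Inter-universal Teichmüller theory II*, kurims manuscript (Dec. 2020), §2: Def. 2.3 (i)(ii) pp. 67–68 («the cuspidal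
inertia groups of `Π^±_v` … [cf. [IUTchI] Def 3.1 (e)] … those of `Π_⊆` may be obtained as the intersections with `Π_⊆` of those cuspidal
inertia groups of `Π_⊇` …»), Rmk. 2.3.1 p. 69 («`I ≅ Ẑ(1)`», «`I ∩ Π_⊆ = I^l`») ([IUTchII] Def 2.3 (ii), kurims p.68)
[claim: Mochizuki2012, status: disputed]; S. Mochizuki, *Semi-graphs of anabelioids*, Publ. RIMS **42** (2006) [SemiAnbd], §6 p. 71
(«`I_x := D_x ∩ Δ^temp_X` is isomorphic to `Ẑ(1)` … if `x` is a cusp») [cite: MochizukiSemiAnbd2006, §6 p.71].  abc-iut cell, layer L6, seat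
abc-iut-L6-t19 (gen 6), NV bookkeeping for IUTchII:Def2.3(ii)(iii), Rmk2.3.1, Cor2.4(iii) (a discharged row may not rest on a vacuous ∀-clause).

WHY.  The cell's genuine §2 theorems at the tower of record (`StableCurveAgreement.def23_ii'_genuine` p445460, `rmk231_powers_genuine` p444107,
`isCuspidalInertia_piV_conj_cor_genuine` p446219, the package `exists_agreements_ofPiCHat_with_piV_dictionary` p441069) quantify universally over
the cuspidal inertia groups of a datum `Cu` tied to the [IUTchI] §2 datum of `X̲_v` by an AGREEMENT `A : StableCurveAgreement W Cu Du`
(abc-iut-w5-d132 p434636: generated AT THE LEVEL `Π^±_v` by the special-fibre cusp inertia groups of `X̲_v`, the other levels by INTERSECTION).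
For the OTHER datum built at the genuine tower — the CONTAINMENT-keyed one of p430433 — abc-iut-w4-d005 proved the family at the level `Π_v`
EMPTY (`isEmpty_cuspidalInertia_piV_of_containment`, p442973), which made an assembly over it vacuous.  This file records, in OUR kernel, that
the agreement datum is NOT of that kind:
* §1 (any agreement): every cusp `x` of `D` and `t ∈ Π^tp` give a cuspidal inertia group `I` of `Π^±_v` with `eHat(I) = toHat(t I_x t⁻¹)`
  (`exists_isCuspidalInertia_piPM_map_eq`); under the levels clause the family at EVERY level `Q` is then inhabited
  (`exists_isCuspidalInertia_of_levels`);
* §2 (over abc-iut-L5's `ofSpecialFibre Y`): a member of a family transported to the level `Π_v` along `eV : Π̂_v ⥲ Π̂_Y` with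
  `eV ∘ emb ∘ incl = toHat ∘ ψ` is `≃ₜ* Ẑ` (`nonempty_equiv_zHat_of_piV_map_eq`; the `Π^±_v`-level sibling is p443151), so `≠ ⊥` and infinite;
* §3 (the tower of record `ofPiCHat` over `BadPlaceSetting.ofUnderline`, data of `X̲_v` / `X̲̲_v` = abc-iut-L6-t7's tempered curves): given ONE
  cusp `x` of `X` (the point `(x, Π^tp_{X̲_v}·1·D_x)` of `X̲_v` over it is a cusp), for EVERY `Cu`, `A`: the family at `Π^±_v` is inhabited,
  under the levels clause every level's family is inhabited, every member at `Π^±_v` (clause (i)) and at `Π_v` (the `Π_v`-dictionary of p440804)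
  is `≃ₜ* Ẑ`, `≠ ⊥`, infinite; PACKAGE `exists_agreements_ofPiCHat_nonVacuous` = p441069's `∃ Cu A eV` with these clauses adjoined.

HONEST LIMITS: existence of a cusp of `X` is a HYPOTHESIS (`x`, `hx : IsCusp x` — the (1,1) curve's unique cusp is not a field of the root
interface); nothing here counts the families (`|LabCusp^±| = l` is abc-iut-w5-d132's DEF23V row); no new `def`, no instance, no edit of any other
seat's file; nothing of the series is asserted; consistency ≠ endorsement; no side taken on [IUTchIII] Cor. 3.12; typed ≠ proved.
-/

noncomputable section

namespace Literature.IUT.HodgeArakelov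

open Literature.AnabelianGeometry.EtaleTheta Literature.AnabelianGeometry.SemiGraphs Literature.IUT.HodgeTheaters
open scoped Pointwise

universe u

namespace PlusMinusTower

section Transport

variable {G G' : Type*} [Group G] [TopologicalSpace G] [Group G'] [TopologicalSpace G']

/-- The image of a subgroup under an isomorphism of topological groups is isomorphic to it as a topological group. [folklore] -/
private theorem nonempty_continuousMulEquiv_map_equiv' (e : G ≃ₜ* G') (K : Subgroup G) :
    Nonempty (↥K ≃ₜ* ↥(K.map e.toMulEquiv.toMonoidHom)) := by
  refine ⟨{ e.toMulEquiv.subgroupMap K with continuous_toFun := ?_, continuous_invFun := ?_ }⟩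
  · exact (e.continuous.comp continuous_subtype_val).subtype_mk _
  · exact (e.symm.continuous.comp continuous_subtype_val).subtype_mk _

/-- A subgroup isomorphic (as a topological group) to `Ẑ` is infinite, hence not trivial (`Ẑ` is infinite:
`EtaleTheta.SettingModel.infinite_zHat`). [cite: MochizukiSemiAnbd2006, §6 p.71] -/
theorem ne_bot_and_infinite_of_equiv_zHat {I : Subgroup G}
    (h : Nonempty (↥I ≃ₜ* Literature.AnabelianGeometry.SemiGraphs.ZHat)) : I ≠ ⊥ ∧ Infinite ↥I := by
  obtain ⟨e⟩ := h
  haveI : Infinite Literature.AnabelianGeometry.SemiGraphs.ZHat :=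
    Literature.AnabelianGeometry.EtaleTheta.SettingModel.infinite_zHat
  haveI : Infinite ↥I := Infinite.of_injective e.symm e.symm.injective
  refine ⟨?_, inferInstance⟩
  intro hbot
  obtain ⟨z, hz⟩ := exists_ne (1 : ↥I)
  apply hz
  have hmem : (z : G) ∈ (⊥ : Subgroup G) := hbot.le z.2
  exact Subtype.ext (Subgroup.mem_bot.mp hmem)

end Transport

/-! ## §1 Generic: the family of an agreement is inhabited at `Π^±_v`, and under the levels clause at every level -/

section Generic

variable {S : BadPlaceSetting.{u}} {P : TopGroup.{u}} {T : TemperedCoverings S P}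
variable {W : PlusMinusTower T} {C : CuspidalInertiaData W} {D : StableCurveTemperedData.{u}}

/-- **[IUTchII] Def 2.3 (ii), non-vacuity at `Π^±_v`.**  For an agreement `A` of a `±`-tower's cuspidal datum with an [IUTchI] §2 datum `D`, every
cusp `x` of `D` and every `t ∈ Π^tp_{X_v}` yield the cuspidal inertia group `I := eHat⁻¹(toHat(t · I_x · t⁻¹)) ⊆ Π^±_v`, with
`eHat(I) = toHat(t · I_x · t⁻¹)`.  PROVED (`A.inertia_iff`, `A.map_piPM`). ([IUTchII] Def 2.3 (ii), kurims p.68) [claim: Mochizuki2012, status: disputed] -/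
theorem StableCurveAgreement.exists_isCuspidalInertia_piPM_map_eq (A : StableCurveAgreement W C D) (x : D.Cusp) (t : D.PiTp) :
    ∃ I : Subgroup W.Corhat, C.IsCuspidalInertia W.piPM I ∧
      (I.subgroupOf W.pmHat).map A.eHat.toMonoidHom =
        (MulAut.conj t • (D.inertiaTp x).map D.DeltaTp.subtype).map D.ιX := by
  set K : Subgroup D.PiHat := (MulAut.conj t • (D.inertiaTp x).map D.DeltaTp.subtype).map D.ιX with hKdef
  have hsub : ((K.comap A.eHat.toMonoidHom).map W.pmHat.subtype).subgroupOf W.pmHat = K.comap A.eHat.toMonoidHom := by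
    show Subgroup.comap W.pmHat.subtype _ = _
    exact Subgroup.comap_map_eq_self_of_injective W.pmHat.subtype_injective _
  have hmap : (((K.comap A.eHat.toMonoidHom).map W.pmHat.subtype).subgroupOf W.pmHat).map A.eHat.toMonoidHom = K := by
    rw [hsub]
    refine Subgroup.map_comap_eq_self_of_surjective ?_ _
    intro v
    exact ⟨A.eHat.symm v, by simp⟩
  refine ⟨(K.comap A.eHat.toMonoidHom).map W.pmHat.subtype, (A.inertia_iff _).mpr ⟨?_, x, t, hmap⟩, hmap⟩
  rintro _ ⟨q, hq, rfl⟩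
  refine (A.mem_piPM_iff q).mpr ?_
  obtain ⟨w, -, hw⟩ := Subgroup.mem_map.mp (Subgroup.mem_comap.mp hq)
  exact ⟨w, hw⟩

/-- **[IUTchII] Def 2.3 (ii), non-vacuity at `Π^±_v`**: each cusp of `D` gives a cuspidal inertia group of `Π^±_v`.  PROVED.
([IUTchII] Def 2.3 (ii), kurims p.68) [claim: Mochizuki2012, status: disputed] -/
theorem StableCurveAgreement.exists_isCuspidalInertia_piPM (A : StableCurveAgreement W C D) (x : D.Cusp) :
    ∃ I : Subgroup W.Corhat, C.IsCuspidalInertia W.piPM I := by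
  obtain ⟨I, hI, -⟩ := A.exists_isCuspidalInertia_piPM_map_eq x 1
  exact ⟨I, hI⟩

/-- **[IUTchII] Def 2.3 (ii), non-vacuity at every level under the levels clause** («the cuspidal inertia groups of `Π_⊆` [are] the intersections
with `Π_⊆` of [those] of `Π_⊇`»): a cuspidal `I₀` at `Π^±_v` gives the cuspidal `I₀ ∩ Q` at `Q`.  PROVED. ([IUTchII] Def 2.3 (ii), kurims p.68)
[claim: Mochizuki2012, status: disputed] -/
theorem exists_isCuspidalInertia_of_levels (C : CuspidalInertiaData W) {Q : Subgroup W.Corhat}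
    (hlev : ∀ I, C.IsCuspidalInertia Q I ↔ I ≤ Q ∧ ∃ I₀, C.IsCuspidalInertia W.piPM I₀ ∧ I = I₀ ⊓ Q)
    (h : ∃ I₀, C.IsCuspidalInertia W.piPM I₀) : ∃ I, C.IsCuspidalInertia Q I := by
  obtain ⟨I₀, h₀⟩ := h
  exact ⟨I₀ ⊓ Q, (hlev _).mpr ⟨inf_le_right, I₀, h₀, rfl⟩⟩

end Generic

/-! ## §2 Generic over `ofSpecialFibre Y`: members of a family transported to the level `Π_v` are `≃ₜ* Ẑ` -/

section ZHatV

variable {S : BadPlaceSetting.{0}} {P : TopGroup.{0}} {T : TemperedCoverings S P}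
variable {p : ℕ} [Fact p.Prime] (Y : TemperedCurve p) (d : Y.GroupLevelData)
  (Sf : SpecialFibreData (Y.toTemperedArithmeticGroup d)) (h36 : Sf.Gc.Prop36Hypotheses) (Sigma SigmaHat : Set ℕ)
  (hsub : Sigma ⊆ SigmaHat) (hne : Sigma.Nonempty) (hprime : ∀ q ∈ SigmaHat, q.Prime) (hp : p ∉ Sigma)
  (TpH : Subgroup Sf.chart.G) (HatH : Subgroup (TemperedGraphGroupData.exists_completion_of_prop36 Sf.Gc h36 Sf.chart).choose)
  (hle : TpH.map (TemperedGraphGroupData.exists_completion_of_prop36 Sf.Gc h36 Sf.chart).choose_spec.choose.toMonoidHom ≤ HatH)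
  (cuspMeetsH : {x : Y.Pt // Y.IsCusp x} → Prop)

/-- **[IUTchII] Rmk 2.3.1 input «`I ≅ Ẑ(1)`» AT THE LEVEL `Π_v`.**  `W` a `±`-tower with `Π̂^cor_v` Hausdorff and `emb` continuous, `eV : Π̂_v ⥲ Π̂_Y`
onto the [IUTchI] §2 datum of a tempered curve `Y` with `eV ∘ emb ∘ incl = toHat ∘ ψ` (`ψ : P ≃ₜ* Π^tp_Y`), `I ⊆ Π_v` carried by `eV` onto
`toHat(s I_y s⁻¹)` (`y` a cusp of `Y`, `s ∈ Π^tp_Y`) ⟹ `I ≃ₜ* Ẑ` (`I_y ≃ₜ* Ẑ` = abc-iut-L3's interface field `inertia_equiv_zHat`; `emb ∘ incl` on the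
compact `ψ⁻¹(s I_y s⁻¹)` is a homeomorphism onto `I`).  PROVED. ([IUTchII] Rmk 2.3.1, kurims p.69) [cite: MochizukiSemiAnbd2006, §6 p.71]
[claim: Mochizuki2012, status: disputed] -/
theorem nonempty_equiv_zHat_of_piV_map_eq {W : PlusMinusTower T} [T2Space W.Corhat] (hemb : Continuous W.emb)
    (eV : ↥W.hat ≃* (StableCurveTemperedData.ofSpecialFibre Y d Sf h36 Sigma SigmaHat hsub hne hprime hp TpH HatH hle cuspMeetsH).PiHat)
    (ψ : P ≃ₜ* Y.PiTemp)
    (hV : ∀ z : P, eV ⟨W.emb (T.incl z), W.embP_le_hat ⟨z, rfl⟩⟩ =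
      (StableCurveTemperedData.ofSpecialFibre Y d Sf h36 Sigma SigmaHat hsub hne hprime hp TpH HatH hle cuspMeetsH).ιX (ψ z))
    {I : Subgroup W.Corhat} (hIle : I ≤ W.piV)
    (y : (StableCurveTemperedData.ofSpecialFibre Y d Sf h36 Sigma SigmaHat hsub hne hprime hp TpH HatH hle cuspMeetsH).Cusp)
    (s : (StableCurveTemperedData.ofSpecialFibre Y d Sf h36 Sigma SigmaHat hsub hne hprime hp TpH HatH hle cuspMeetsH).PiTp)
    (hEq : (I.subgroupOf W.hat).map eV.toMonoidHom =
      (MulAut.conj s • ((StableCurveTemperedData.ofSpecialFibre Y d Sf h36 Sigma SigmaHat hsub hne hprime hp TpH HatH hle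
          cuspMeetsH).inertiaTp y).map
        (StableCurveTemperedData.ofSpecialFibre Y d Sf h36 Sigma SigmaHat hsub hne hprime hp TpH HatH hle cuspMeetsH).DeltaTp.subtype).map
      (StableCurveTemperedData.ofSpecialFibre Y d Sf h36 Sigma SigmaHat hsub hne hprime hp TpH HatH hle cuspMeetsH).ιX) :
    Nonempty (↥I ≃ₜ* Literature.AnabelianGeometry.SemiGraphs.ZHat) := by
  rw [map_subtype_inertiaTp_ofSpecialFibre Y d Sf h36 Sigma SigmaHat hsub hne hprime hp TpH HatH hle cuspMeetsH y] at hEq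
  obtain ⟨e₀⟩ := Y.inertia_equiv_zHat y.1 y.2
  obtain ⟨e₁⟩ := CosetCat.nonempty_continuousMulEquiv_conj (Y.decomp y.1 ⊓ Y.aug.toMonoidHom.ker) (s : Y.PiTemp)
  set K : Subgroup Y.PiTemp := MulAut.conj (s : Y.PiTemp) • (Y.decomp y.1 ⊓ Y.aug.toMonoidHom.ker) with hKdef
  let eK : ↥K ≃ₜ* Literature.AnabelianGeometry.SemiGraphs.ZHat := e₁.symm.trans e₀
  obtain ⟨e₂⟩ := nonempty_continuousMulEquiv_map_equiv' ψ.symm K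
  set K' : Subgroup P := K.map ψ.symm.toMulEquiv.toMonoidHom with hK'def
  -- membership in `I`: `emb (incl z) ∈ I ↔ ψ z ∈ K`
  have hmem : ∀ z : P, W.emb (T.incl z) ∈ I ↔ ψ z ∈ K := fun z =>
    emb_incl_mem_iff_of_map_eq eV (fun z => ψ z) hV hEq z
  have hwd : ∀ k : K', W.emb (T.incl (k : P)) ∈ I := by
    rintro ⟨_, k₀, hk₀, rfl⟩
    refine (hmem _).mpr ?_
    change ψ (ψ.symm k₀) ∈ K
    rw [ContinuousMulEquiv.apply_symm_apply]
    exact hk₀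
  let g : ↥K' →* ↥I :=
    { toFun := fun k => ⟨W.emb (T.incl (k : P)), hwd k⟩
      map_one' := Subtype.ext (by simp)
      map_mul' := fun a b => Subtype.ext (by simp) }
  have hg_inj : Function.Injective g := by
    intro a b hab
    apply Subtype.ext
    exact T.incl_isOpenEmbedding.injective (W.emb_injective (congrArg Subtype.val hab))
  have hg_surj : Function.Surjective g := by
    rintro ⟨i, hi⟩
    obtain ⟨z, rfl⟩ := hIle hi
    have hzK : ψ z ∈ K := (hmem z).mp hi
    refine ⟨⟨z, ⟨ψ z, hzK, ?_⟩⟩, rfl⟩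
    change ψ.symm (ψ z) = z
    rw [ContinuousMulEquiv.symm_apply_apply]
  have hg_cont : Continuous g :=
    ((hemb.comp T.incl_isOpenEmbedding.continuous).comp continuous_subtype_val).subtype_mk _
  haveI : CompactSpace ↥K' := (e₂.symm.trans eK).toHomeomorph.symm.compactSpace
  let gE : ↥K' ≃ ↥I := Equiv.ofBijective g ⟨hg_inj, hg_surj⟩
  have hgE : Continuous gE := hg_cont
  let gH : ↥K' ≃ₜ ↥I := Continuous.homeoOfEquivCompactToT2 hgE
  let gM : ↥K' ≃ₜ* ↥I :=
    { MulEquiv.ofBijective g ⟨hg_inj, hg_surj⟩ with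
      continuous_toFun := hg_cont
      continuous_invFun := gH.symm.continuous }
  exact ⟨(gM.symm.trans e₂.symm).trans eK⟩

end ZHatV

/-! ## §3 At the tower of record `ofPiCHat` over `BadPlaceSetting.ofUnderline` -/

section Record

variable {p : ℕ} [Fact p.Prime] {M : MuTwoSetting p} (e : M.CLevelData)
  {E : M.toThetaSetting.EtaleThetaData} {l : ℕ} (C : E.DoubleUnderline l) {N : ℕ+}
  (μ : M.toThetaSetting.CyclotomeMod l N) (hC : M.toThetaSetting.Compat) (hS : M.toThetaSetting.Sec2Hyps)
  (hl : l.Prime) (hp2 : p ≠ 2) (hpl : p ≠ l) (hζ : ∃ ζ : M.toThetaSetting.K, IsPrimitiveRoot ζ (4 * l))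
  {η : (C.thetaEnvData μ hC hS).PiYdd → MuN p N} (hη : η ∈ (C.thetaEnvData μ hC hS).thetaCocycles)
  (hZ : Thm16Sub.KerToZIsCompactlyGenerated M.toThetaSetting) (hN : (C.Huu.subgroupOf (M.GtpXu l)).Normal)
  {P : TopGroup.{0}} (T : TemperedCoverings (BadPlaceSetting.ofUnderline C μ hC hS hl hp2 hpl hζ hη) P)
  (d : M.toTemperedCurve.GroupLevelData)
  (Sfu : SpecialFibreData ((M.toThetaSetting.temperedCurveXuOfLevelData l C.l_ne_zero d).toTemperedArithmeticGroup
    (M.toThetaSetting.groupLevelDataXu l C.l_ne_zero d)))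
  (h36u : Sfu.Gc.Prop36Hypotheses) (Sigmau SigmaHatu : Set ℕ) (hsubu : Sigmau ⊆ SigmaHatu) (hneu : Sigmau.Nonempty)
  (hprimeu : ∀ q ∈ SigmaHatu, q.Prime) (hpu : p ∉ Sigmau) (TpHu : Subgroup Sfu.chart.G)
  (HatHu : Subgroup (TemperedGraphGroupData.exists_completion_of_prop36 Sfu.Gc h36u Sfu.chart).choose)
  (hleu : TpHu.map (TemperedGraphGroupData.exists_completion_of_prop36 Sfu.Gc h36u Sfu.chart).choose_spec.choose.toMonoidHom ≤ HatHu)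
  (cuspu : {x : (M.toThetaSetting.temperedCurveXuOfLevelData l C.l_ne_zero d).Pt //
    (M.toThetaSetting.temperedCurveXuOfLevelData l C.l_ne_zero d).IsCusp x} → Prop)
  (Sf : SpecialFibreData ((C.temperedCurveXuuOfLevelData C.l_ne_zero d).toTemperedArithmeticGroup
    (C.groupLevelDataXuu C.l_ne_zero d)))
  (h36 : Sf.Gc.Prop36Hypotheses) (Sigma SigmaHat : Set ℕ) (hsub : Sigma ⊆ SigmaHat) (hne : Sigma.Nonempty)
  (hprime : ∀ q ∈ SigmaHat, q.Prime) (hp : p ∉ Sigma) (TpH : Subgroup Sf.chart.G)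
  (HatH : Subgroup (TemperedGraphGroupData.exists_completion_of_prop36 Sf.Gc h36 Sf.chart).choose)
  (hle : TpH.map (TemperedGraphGroupData.exists_completion_of_prop36 Sf.Gc h36 Sf.chart).choose_spec.choose.toMonoidHom ≤ HatH)
  (cuspMeetsH : {x : (C.temperedCurveXuuOfLevelData C.l_ne_zero d).Pt //
    (C.temperedCurveXuuOfLevelData C.l_ne_zero d).IsCusp x} → Prop)

/-- The point `(x, Π^tp_{X̲_v} · 1 · D_x)` of `X̲_v` over a cusp `x` of `X` is a cusp of `X̲_v` (abc-iut-L3's `ofOpenSubgroup`: the points of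
`X_H` over `x` are the double cosets `H \ Π^tp_X / D_x`, cusps over cusps). ([IUTchI] Def 3.1 (e), kurims p.62)
[cite: MochizukiSemiAnbd2006, §6 pp.69-71] [claim: Mochizuki2012, status: disputed] -/
theorem isCusp_temperedCurveXuOfLevelData_mk {x : M.toTemperedCurve.Pt} (hx : M.toTemperedCurve.IsCusp x) :
    (M.toThetaSetting.temperedCurveXuOfLevelData l C.l_ne_zero d).IsCusp
      (⟨x, DoubleCoset.mk (M.GtpXu l) (M.toTemperedCurve.decomp x) 1⟩ :
        M.toTemperedCurve.PtOfOpen (M.GtpXu l)) := hx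

/-- The same for `X̲̲_v`: `(x, Π^tp_{X̲̲_v} · 1 · D_x)` is a cusp of `X̲̲_v` over the cusp `x` of `X`. ([IUTchI] Def 3.1 (e), kurims p.62)
[cite: MochizukiSemiAnbd2006, §6 pp.69-71] [claim: Mochizuki2012, status: disputed] -/
theorem isCusp_temperedCurveXuuOfLevelData_mk {x : M.toTemperedCurve.Pt} (hx : M.toTemperedCurve.IsCusp x) :
    (C.temperedCurveXuuOfLevelData C.l_ne_zero d).IsCusp
      (⟨x, DoubleCoset.mk C.Huu (M.toTemperedCurve.decomp x) 1⟩ : M.toTemperedCurve.PtOfOpen C.Huu) := hx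

/-- **[IUTchII] Def 2.3 (ii) at the tower of record — NON-VACUITY at `Π^±_v`.**  For EVERY cuspidal datum `Cu` of
`W := PlusMinusTower.ofPiCHat …` and EVERY agreement `A` of it with the [IUTchI] §2 datum of `X̲_v`, each cusp `x` of `X` yields a cuspidal
inertia group of `Π^±_v`.  PROVED. ([IUTchII] Def 2.3 (ii), kurims p.68) [claim: Mochizuki2012, status: disputed] -/
theorem StableCurveAgreement.exists_isCuspidalInertia_piPM_ofPiCHat
    {Cu : CuspidalInertiaData (ofPiCHat e C μ hC hS hl hp2 hpl hζ hη hZ hN T)}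
    (A : StableCurveAgreement (ofPiCHat e C μ hC hS hl hp2 hpl hζ hη hZ hN T) Cu
      (StableCurveTemperedData.ofSpecialFibre (M.toThetaSetting.temperedCurveXuOfLevelData l C.l_ne_zero d)
        (M.toThetaSetting.groupLevelDataXu l C.l_ne_zero d) Sfu h36u Sigmau SigmaHatu hsubu hneu hprimeu hpu TpHu HatHu hleu cuspu))
    {x : M.toTemperedCurve.Pt} (hx : M.toTemperedCurve.IsCusp x) :
    ∃ I : Subgroup (ofPiCHat e C μ hC hS hl hp2 hpl hζ hη hZ hN T).Corhat,
      Cu.IsCuspidalInertia (ofPiCHat e C μ hC hS hl hp2 hpl hζ hη hZ hN T).piPM I :=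
  A.exists_isCuspidalInertia_piPM ⟨_, isCusp_temperedCurveXuOfLevelData_mk C d hx⟩

/-- **[IUTchII] Def 2.3 (ii) at the tower of record — NON-VACUITY at EVERY level** under the levels clause of the agreement of record
(p434636): each cusp of `X` yields a cuspidal inertia group at every level `Q` (in particular at `Π_v`, in contrast with the EMPTY
`Π_v`-family of the containment-keyed datum, abc-iut-w4-d005's `isEmpty_cuspidalInertia_piV_of_containment`).  PROVED.
([IUTchII] Def 2.3 (ii), kurims p.68) [claim: Mochizuki2012, status: disputed] -/
theorem StableCurveAgreement.exists_isCuspidalInertia_ofPiCHat_of_levels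
    {Cu : CuspidalInertiaData (ofPiCHat e C μ hC hS hl hp2 hpl hζ hη hZ hN T)}
    (A : StableCurveAgreement (ofPiCHat e C μ hC hS hl hp2 hpl hζ hη hZ hN T) Cu
      (StableCurveTemperedData.ofSpecialFibre (M.toThetaSetting.temperedCurveXuOfLevelData l C.l_ne_zero d)
        (M.toThetaSetting.groupLevelDataXu l C.l_ne_zero d) Sfu h36u Sigmau SigmaHatu hsubu hneu hprimeu hpu TpHu HatHu hleu cuspu))
    (hlev : ∀ (Q I : Subgroup (ofPiCHat e C μ hC hS hl hp2 hpl hζ hη hZ hN T).Corhat), Cu.IsCuspidalInertia Q I ↔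
      I ≤ Q ∧ ∃ I₀, Cu.IsCuspidalInertia (ofPiCHat e C μ hC hS hl hp2 hpl hζ hη hZ hN T).piPM I₀ ∧ I = I₀ ⊓ Q)
    {x : M.toTemperedCurve.Pt} (hx : M.toTemperedCurve.IsCusp x) (Q : Subgroup (ofPiCHat e C μ hC hS hl hp2 hpl hζ hη hZ hN T).Corhat) :
    ∃ I, Cu.IsCuspidalInertia Q I :=
  exists_isCuspidalInertia_of_levels Cu (hlev Q) (A.exists_isCuspidalInertia_piPM_ofPiCHat e C μ hC hS hl hp2 hpl hζ hη hZ hN T d Sfu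
    h36u Sigmau SigmaHatu hsubu hneu hprimeu hpu TpHu HatHu hleu cuspu hx)

/-- **[IUTchII] Rmk 2.3.1 «`I ≅ Ẑ(1)`» at the tower of record, level `Π^±_v`**: under clause (i) of the agreement (`eHat ∘ emb = toHat ∘ plainIso`)
every cuspidal inertia group of `Π^±_v` is `≃ₜ* Ẑ`, hence `≠ ⊥` and infinite (p443151 at `ofPiCHat`: `Π̂^cor_v = Π_C` is Hausdorff, `emb` is
continuous by `continuous_emb_ofPiCHat`).  PROVED. ([IUTchII] Rmk 2.3.1, kurims p.69) [cite: MochizukiSemiAnbd2006, §6 p.71]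
[claim: Mochizuki2012, status: disputed] -/
theorem StableCurveAgreement.equiv_zHat_of_isCuspidalInertia_piPM_ofPiCHat
    {Cu : CuspidalInertiaData (ofPiCHat e C μ hC hS hl hp2 hpl hζ hη hZ hN T)}
    (A : StableCurveAgreement (ofPiCHat e C μ hC hS hl hp2 hpl hζ hη hZ hN T) Cu
      (StableCurveTemperedData.ofSpecialFibre (M.toThetaSetting.temperedCurveXuOfLevelData l C.l_ne_zero d)
        (M.toThetaSetting.groupLevelDataXu l C.l_ne_zero d) Sfu h36u Sigmau SigmaHatu hsubu hneu hprimeu hpu TpHu HatHu hleu cuspu))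
    (hA : ∀ w : T.Xplain,
      A.eHat ⟨(ofPiCHat e C μ hC hS hl hp2 hpl hζ hη hZ hN T).emb w, (ofPiCHat e C μ hC hS hl hp2 hpl hζ hη hZ hN T).emb_le_pmHat ⟨w, rfl⟩⟩ =
        (StableCurveTemperedData.ofSpecialFibre (M.toThetaSetting.temperedCurveXuOfLevelData l C.l_ne_zero d)
          (M.toThetaSetting.groupLevelDataXu l C.l_ne_zero d) Sfu h36u Sigmau SigmaHatu hsubu hneu hprimeu hpu TpHu HatHu hleu
          cuspu).ιX (T.plainIso w))
    {I : Subgroup (ofPiCHat e C μ hC hS hl hp2 hpl hζ hη hZ hN T).Corhat}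
    (hI : Cu.IsCuspidalInertia (ofPiCHat e C μ hC hS hl hp2 hpl hζ hη hZ hN T).piPM I) :
    Nonempty (↥I ≃ₜ* Literature.AnabelianGeometry.SemiGraphs.ZHat) ∧ I ≠ ⊥ ∧ Infinite ↥I := by
  haveI : T2Space (ofPiCHat e C μ hC hS hl hp2 hpl hζ hη hZ hN T).Corhat := e.isProfiniteCompletion_toPiCHat.t2Space
  have h := StableCurveAgreement.nonempty_equiv_zHat_of_isCuspidalInertia_piPM (M.toThetaSetting.temperedCurveXuOfLevelData l C.l_ne_zero d)
    (M.toThetaSetting.groupLevelDataXu l C.l_ne_zero d) Sfu h36u Sigmau SigmaHatu hsubu hneu hprimeu hpu TpHu HatHu hleu cuspu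
    (continuous_emb_ofPiCHat e C μ hC hS hl hp2 hpl hζ hη hZ hN T) A T.plainIso hA hI
  exact ⟨h, ne_bot_and_infinite_of_equiv_zHat h⟩

/-- **[IUTchII] Rmk 2.3.1 «`I ≅ Ẑ(1)`» at the tower of record, level `Π_v`**: under the `Π_v`-dictionary of the agreement datum (p440804
`isCuspidalInertia_piV_iff_cuspsXuu`, packaged in p441069) along an identification `eV : Π̂_v ⥲ Π̂_{X̲̲_v}` with `eV ∘ emb ∘ incl = toHat ∘ refIso`,
every cuspidal inertia group of `Π_v` is `≃ₜ* Ẑ`, hence `≠ ⊥` and infinite.  PROVED. ([IUTchII] Rmk 2.3.1, kurims p.69)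
[cite: MochizukiSemiAnbd2006, §6 p.71] [claim: Mochizuki2012, status: disputed] -/
theorem equiv_zHat_of_isCuspidalInertia_piV_ofPiCHat
    {Cu : CuspidalInertiaData (ofPiCHat e C μ hC hS hl hp2 hpl hζ hη hZ hN T)}
    (eV : ↥(ofPiCHat e C μ hC hS hl hp2 hpl hζ hη hZ hN T).hat ≃ₜ*
      (StableCurveTemperedData.ofSpecialFibre (C.temperedCurveXuuOfLevelData C.l_ne_zero d)
        (C.groupLevelDataXuu C.l_ne_zero d) Sf h36 Sigma SigmaHat hsub hne hprime hp TpH HatH hle cuspMeetsH).PiHat)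
    (hV : ∀ z : P,
      eV ⟨(ofPiCHat e C μ hC hS hl hp2 hpl hζ hη hZ hN T).emb (T.incl z),
          (ofPiCHat e C μ hC hS hl hp2 hpl hζ hη hZ hN T).embP_le_hat ⟨z, rfl⟩⟩ =
        (StableCurveTemperedData.ofSpecialFibre (C.temperedCurveXuuOfLevelData C.l_ne_zero d)
          (C.groupLevelDataXuu C.l_ne_zero d) Sf h36 Sigma SigmaHat hsub hne hprime hp TpH HatH hle cuspMeetsH).ιX (T.refIso z))
    (hdict : ∀ I : Subgroup (ofPiCHat e C μ hC hS hl hp2 hpl hζ hη hZ hN T).Corhat,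
      Cu.IsCuspidalInertia (ofPiCHat e C μ hC hS hl hp2 hpl hζ hη hZ hN T).piV I ↔
        I ≤ (ofPiCHat e C μ hC hS hl hp2 hpl hζ hη hZ hN T).piV ∧
          ∃ (y : (StableCurveTemperedData.ofSpecialFibre (C.temperedCurveXuuOfLevelData C.l_ne_zero d)
              (C.groupLevelDataXuu C.l_ne_zero d) Sf h36 Sigma SigmaHat hsub hne hprime hp TpH HatH hle cuspMeetsH).Cusp)
            (s : (StableCurveTemperedData.ofSpecialFibre (C.temperedCurveXuuOfLevelData C.l_ne_zero d)
              (C.groupLevelDataXuu C.l_ne_zero d) Sf h36 Sigma SigmaHat hsub hne hprime hp TpH HatH hle cuspMeetsH).PiTp),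
            (I.subgroupOf (ofPiCHat e C μ hC hS hl hp2 hpl hζ hη hZ hN T).hat).map eV.toMulEquiv.toMonoidHom =
              (MulAut.conj s • ((StableCurveTemperedData.ofSpecialFibre (C.temperedCurveXuuOfLevelData C.l_ne_zero d)
                  (C.groupLevelDataXuu C.l_ne_zero d) Sf h36 Sigma SigmaHat hsub hne hprime hp TpH HatH hle cuspMeetsH).inertiaTp y).map
                (StableCurveTemperedData.ofSpecialFibre (C.temperedCurveXuuOfLevelData C.l_ne_zero d)
                  (C.groupLevelDataXuu C.l_ne_zero d) Sf h36 Sigma SigmaHat hsub hne hprime hp TpH HatH hle cuspMeetsH).DeltaTp.subtype).map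
              (StableCurveTemperedData.ofSpecialFibre (C.temperedCurveXuuOfLevelData C.l_ne_zero d)
                (C.groupLevelDataXuu C.l_ne_zero d) Sf h36 Sigma SigmaHat hsub hne hprime hp TpH HatH hle cuspMeetsH).ιX)
    {I : Subgroup (ofPiCHat e C μ hC hS hl hp2 hpl hζ hη hZ hN T).Corhat}
    (hI : Cu.IsCuspidalInertia (ofPiCHat e C μ hC hS hl hp2 hpl hζ hη hZ hN T).piV I) :
    Nonempty (↥I ≃ₜ* Literature.AnabelianGeometry.SemiGraphs.ZHat) ∧ I ≠ ⊥ ∧ Infinite ↥I := by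
  haveI : T2Space (ofPiCHat e C μ hC hS hl hp2 hpl hζ hη hZ hN T).Corhat := e.isProfiniteCompletion_toPiCHat.t2Space
  obtain ⟨hIle, y, s, hEq⟩ := (hdict I).mp hI
  have h := nonempty_equiv_zHat_of_piV_map_eq (C.temperedCurveXuuOfLevelData C.l_ne_zero d) (C.groupLevelDataXuu C.l_ne_zero d) Sf h36
    Sigma SigmaHat hsub hne hprime hp TpH HatH hle cuspMeetsH (continuous_emb_ofPiCHat e C μ hC hS hl hp2 hpl hζ hη hZ hN T)
    eV.toMulEquiv T.refIso hV hIle y s hEq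
  exact ⟨h, ne_bot_and_infinite_of_equiv_zHat h⟩

/-- **THE PACKAGE OF RECORD, NON-VACUOUS — [IUTchII] Def 2.3 (i)(ii) at `v ∈ 𝕍^bad`, tower `ofPiCHat`.**  p441069's `∃ Cu A eV` (clause (i) at
`Π^±_v`, the levels clause, `eV ∘ emb ∘ incl = toHat ∘ refIso`, the `Π_v`-dictionary) with NON-VACUITY adjoined, given ONE cusp `x` of `X`: the family
is INHABITED at `Π^±_v`, at `Π_v` and at every level `Q`, and every member at `Π^±_v` / `Π_v` is `≃ₜ* Ẑ`, `≠ ⊥`, infinite.  PROVED (binders: L02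
`hZ`, `hN`, `d`, the special-fibre DATA of `X̲_v`, `X̲̲_v`, the cusp `x`). ([IUTchII] Def 2.3 (ii), kurims p.68) [cite: MochizukiSemiAnbd2006, §6 p.71]
[claim: Mochizuki2012, status: disputed] -/
theorem exists_agreements_ofPiCHat_nonVacuous {x : M.toTemperedCurve.Pt} (hx : M.toTemperedCurve.IsCusp x) :
    ∃ (Cu : CuspidalInertiaData (ofPiCHat e C μ hC hS hl hp2 hpl hζ hη hZ hN T))
      (A : StableCurveAgreement (ofPiCHat e C μ hC hS hl hp2 hpl hζ hη hZ hN T) Cu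
        (StableCurveTemperedData.ofSpecialFibre (M.toThetaSetting.temperedCurveXuOfLevelData l C.l_ne_zero d)
          (M.toThetaSetting.groupLevelDataXu l C.l_ne_zero d) Sfu h36u Sigmau SigmaHatu hsubu hneu hprimeu hpu TpHu HatHu hleu cuspu))
      (eV : ↥(ofPiCHat e C μ hC hS hl hp2 hpl hζ hη hZ hN T).hat ≃ₜ*
        (StableCurveTemperedData.ofSpecialFibre (C.temperedCurveXuuOfLevelData C.l_ne_zero d)
          (C.groupLevelDataXuu C.l_ne_zero d) Sf h36 Sigma SigmaHat hsub hne hprime hp TpH HatH hle cuspMeetsH).PiHat),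
      (∀ w : T.Xplain,
        A.eHat ⟨(ofPiCHat e C μ hC hS hl hp2 hpl hζ hη hZ hN T).emb w,
            (ofPiCHat e C μ hC hS hl hp2 hpl hζ hη hZ hN T).emb_le_pmHat ⟨w, rfl⟩⟩ =
          (StableCurveTemperedData.ofSpecialFibre (M.toThetaSetting.temperedCurveXuOfLevelData l C.l_ne_zero d)
            (M.toThetaSetting.groupLevelDataXu l C.l_ne_zero d) Sfu h36u Sigmau SigmaHatu hsubu hneu hprimeu hpu TpHu HatHu hleu
            cuspu).ιX (T.plainIso w)) ∧
      (∀ (Q I : Subgroup (ofPiCHat e C μ hC hS hl hp2 hpl hζ hη hZ hN T).Corhat), Cu.IsCuspidalInertia Q I ↔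
        I ≤ Q ∧ ∃ I₀, Cu.IsCuspidalInertia (ofPiCHat e C μ hC hS hl hp2 hpl hζ hη hZ hN T).piPM I₀ ∧ I = I₀ ⊓ Q) ∧
      (∀ z : P,
        eV ⟨(ofPiCHat e C μ hC hS hl hp2 hpl hζ hη hZ hN T).emb (T.incl z),
            (ofPiCHat e C μ hC hS hl hp2 hpl hζ hη hZ hN T).embP_le_hat ⟨z, rfl⟩⟩ =
          (StableCurveTemperedData.ofSpecialFibre (C.temperedCurveXuuOfLevelData C.l_ne_zero d)
            (C.groupLevelDataXuu C.l_ne_zero d) Sf h36 Sigma SigmaHat hsub hne hprime hp TpH HatH hle cuspMeetsH).ιX (T.refIso z)) ∧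
      (∀ I : Subgroup (ofPiCHat e C μ hC hS hl hp2 hpl hζ hη hZ hN T).Corhat,
        Cu.IsCuspidalInertia (ofPiCHat e C μ hC hS hl hp2 hpl hζ hη hZ hN T).piV I ↔
          I ≤ (ofPiCHat e C μ hC hS hl hp2 hpl hζ hη hZ hN T).piV ∧
            ∃ (y : (StableCurveTemperedData.ofSpecialFibre (C.temperedCurveXuuOfLevelData C.l_ne_zero d)
                (C.groupLevelDataXuu C.l_ne_zero d) Sf h36 Sigma SigmaHat hsub hne hprime hp TpH HatH hle cuspMeetsH).Cusp)
              (s : (StableCurveTemperedData.ofSpecialFibre (C.temperedCurveXuuOfLevelData C.l_ne_zero d)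
                (C.groupLevelDataXuu C.l_ne_zero d) Sf h36 Sigma SigmaHat hsub hne hprime hp TpH HatH hle cuspMeetsH).PiTp),
              (I.subgroupOf (ofPiCHat e C μ hC hS hl hp2 hpl hζ hη hZ hN T).hat).map eV.toMulEquiv.toMonoidHom =
                (MulAut.conj s • ((StableCurveTemperedData.ofSpecialFibre (C.temperedCurveXuuOfLevelData C.l_ne_zero d)
                    (C.groupLevelDataXuu C.l_ne_zero d) Sf h36 Sigma SigmaHat hsub hne hprime hp TpH HatH hle cuspMeetsH).inertiaTp y).map
                  (StableCurveTemperedData.ofSpecialFibre (C.temperedCurveXuuOfLevelData C.l_ne_zero d)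
                    (C.groupLevelDataXuu C.l_ne_zero d) Sf h36 Sigma SigmaHat hsub hne hprime hp TpH HatH hle cuspMeetsH).DeltaTp.subtype).map
                (StableCurveTemperedData.ofSpecialFibre (C.temperedCurveXuuOfLevelData C.l_ne_zero d)
                  (C.groupLevelDataXuu C.l_ne_zero d) Sf h36 Sigma SigmaHat hsub hne hprime hp TpH HatH hle cuspMeetsH).ιX) ∧
      -- NON-VACUITY
      (∃ I, Cu.IsCuspidalInertia (ofPiCHat e C μ hC hS hl hp2 hpl hζ hη hZ hN T).piPM I) ∧
      (∃ I, Cu.IsCuspidalInertia (ofPiCHat e C μ hC hS hl hp2 hpl hζ hη hZ hN T).piV I) ∧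
      (∀ Q : Subgroup (ofPiCHat e C μ hC hS hl hp2 hpl hζ hη hZ hN T).Corhat, ∃ I, Cu.IsCuspidalInertia Q I) ∧
      (∀ I, Cu.IsCuspidalInertia (ofPiCHat e C μ hC hS hl hp2 hpl hζ hη hZ hN T).piPM I →
        Nonempty (↥I ≃ₜ* Literature.AnabelianGeometry.SemiGraphs.ZHat) ∧ I ≠ ⊥ ∧ Infinite ↥I) ∧
      (∀ I, Cu.IsCuspidalInertia (ofPiCHat e C μ hC hS hl hp2 hpl hζ hη hZ hN T).piV I →
        Nonempty (↥I ≃ₜ* Literature.AnabelianGeometry.SemiGraphs.ZHat) ∧ I ≠ ⊥ ∧ Infinite ↥I) := by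
  obtain ⟨Cu, A, eV, hA, hlev, hV, -, -, hdict⟩ := exists_agreements_ofPiCHat_with_piV_dictionary e C μ hC hS hl hp2 hpl hζ hη hZ hN T d
    Sfu h36u Sigmau SigmaHatu hsubu hneu hprimeu hpu TpHu HatHu hleu cuspu Sf h36 Sigma SigmaHat hsub hne hprime hp TpH HatH hle cuspMeetsH
  have hPM := A.exists_isCuspidalInertia_piPM_ofPiCHat e C μ hC hS hl hp2 hpl hζ hη hZ hN T d Sfu h36u Sigmau SigmaHatu hsubu hneu hprimeu
    hpu TpHu HatHu hleu cuspu hx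
  refine ⟨Cu, A, eV, hA, hlev, hV, hdict, hPM, exists_isCuspidalInertia_of_levels Cu (hlev _) hPM,
    fun Q => exists_isCuspidalInertia_of_levels Cu (hlev Q) hPM, fun I hI => ?_, fun I hI => ?_⟩
  · exact A.equiv_zHat_of_isCuspidalInertia_piPM_ofPiCHat e C μ hC hS hl hp2 hpl hζ hη hZ hN T d Sfu h36u Sigmau SigmaHatu hsubu hneu
      hprimeu hpu TpHu HatHu hleu cuspu hA hI
  · exact equiv_zHat_of_isCuspidalInertia_piV_ofPiCHat e C μ hC hS hl hp2 hpl hζ hη hZ hN T d Sf h36 Sigma SigmaHat hsub hne hprime hp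
      TpH HatH hle cuspMeetsH eV hV hdict hI

end Record

end PlusMinusTower

end Literature.IUT.HodgeArakelov

end
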